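import Summits.Schanuel.Schanuel.Theorems.RootDecomp1EScaleTransfer03

/-!
# RootDecomp1EScaleTransfer — lens 2, generation 35 «SCALE-TRANSFER CELL» (ScaleTransfer.lean bf37e395…, 1670 l) — continuation (RootDecomp1EScaleTransfer04): §5b the member tuples `z_Q⁽⁴⁾ = ξ_Q · (1, √2, i, i√2)` / `z_Q⁽³⁾` (`s2`, `ω4`, `y3`, `M4`/`M3`, `hyperScaleApprox_xiQ4` / `_xiQ3` HYPOTHESIS-FREE, `zQ4_eStable`, `schanuel_at_zQ4` / `_zQ3`, `item31409_applied_at_zQ4`); §5c plainness of `z_Q⁽³⁾`, induction binders at `n = 3`, `item31410_applied_at_zQ3` / `item25020_applied_at_zQ3`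

(lens-2 g35 `ScaleTransfer.lean`, sha256 bf37e395…8f98, own farm rc 0 · 0 sorry · axioms std; critic VERDICT STATUS L1636 (d) PORT GO LOW;
port by census-1 gen 15 in five parts `RootDecomp1EScaleTransfer01`–`05` — see the PORT NOTE of part 01; `--supports stmt-Schanuel-31409`; rung 0.)
-/

noncomputable section

open Complex IntermediateField
open Summit.Schanuel.Schanuel.Theorems.RootDecomp1KHyper (LWMeasure SB SFset mvlen mvlen_nonneg
  abs_coeff_le_mvlen one_le_mvlen exists_int_mul_eq_map mvaeval_int_map sb_of_algebraicIndependent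
  mem_adjoin_SFset_I' form_ne_zero_of_linearIndependent)

namespace Summit.Schanuel.Schanuel.Theorems.RootDecomp1EScaleTransfer

variable {D n : ℕ}

/-- `√2 · √2 = 2`. -/
private theorem sqrt_two_mul_self : Real.sqrt 2 * Real.sqrt 2 = 2 :=
  Real.mul_self_sqrt (by norm_num)

/-! ### §5b The member tuples `z_Q⁽⁴⁾ = ξ_Q · (1, √2, i, i√2)` (`n = 4`, E-stable: a line over the
quartic field `ℚ(√2, i)`) and `z_Q⁽³⁾ = ξ_Q · (1, √2, i)` (`n = 3`, plain) -/

/-- `√2` as a complex number. -/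
def s2 : ℂ := (Real.sqrt 2 : ℂ)

/-- `s2 · s2 = 2` in `ℂ` (`s2 = √2`). -/
theorem s2_mul_s2 : s2 * s2 = 2 := by
  unfold s2; rw [← Complex.ofReal_mul, sqrt_two_mul_self]; norm_num

/-- The order basis `ω = (1, √2, i, i√2)` of `ℤ[√2, i]` (algebraic, ℚ-free). -/
def ω4 : Fin 4 → ℂ := ![1, s2, I, I * s2]

/-- `y⁽³⁾ = (1, √2, i)`: the first three coordinates of `ω`. -/
def y3 : Fin 3 → ℂ := fun j => ω4 (Fin.castSucc j)

/-- The matrix of multiplication by `A + B√2` on `ω` (columns = coordinates of `(A + B√2) ω_j`). -/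
def M4 (A B : ℤ) : Fin 4 → Fin 4 → ℤ :=
  ![![A, 2 * B, 0, 0], ![B, A, 0, 0], ![0, 0, A, 2 * B], ![0, 0, B, A]]

/-- Its first three columns (multiplication by `A + B√2` on `y⁽³⁾`, valued in the ℤ-span of `ω`). -/
def M3 (A B : ℤ) : Fin 4 → Fin 3 → ℤ := fun i j => M4 A B i (Fin.castSucc j)

/-- Multiplication by `A + B√2` acts on the frame `ω4 = (1, √2, i, i√2)` through the integer matrix `M4 A B`. -/
theorem lattice4 (A B : ℤ) (j : Fin 4) :
    ((A : ℂ) + (B : ℂ) * s2) * ω4 j = ∑ i, (M4 A B i j : ℂ) * ω4 i := by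
  have h2 := s2_mul_s2
  fin_cases j
  · simp [M4, ω4, Fin.sum_univ_four]
  · simp [M4, ω4, Fin.sum_univ_four]; linear_combination (B : ℂ) * h2
  · simp [M4, ω4, Fin.sum_univ_four]; ring
  · simp [M4, ω4, Fin.sum_univ_four]; linear_combination ((B : ℂ) * I) * h2

/-- Multiplication by `A + B√2` maps the frame `y3 = (1, √2, i)` into `span_ℤ ω4` through `M3 A B`. -/
theorem lattice3 (A B : ℤ) (j : Fin 3) :
    ((A : ℂ) + (B : ℂ) * s2) * y3 j = ∑ i, (M3 A B i j : ℂ) * ω4 i :=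
  lattice4 A B (Fin.castSucc j)

/-- `msize (M4 A B) ≤ 32 (|A| + |B|)`. -/
theorem msize_M4_le (A B : ℤ) : msize (M4 A B) ≤ 32 * (A.natAbs + B.natAbs) := by
  have hb : ∀ i j, (M4 A B i j).natAbs ≤ 2 * (A.natAbs + B.natAbs) := by
    intro i j
    fin_cases i <;> fin_cases j <;> simp [M4, Int.natAbs_mul] <;> omega
  calc msize (M4 A B) = ∑ i, ∑ j, (M4 A B i j).natAbs := rfl
    _ ≤ ∑ _i : Fin 4, ∑ _j : Fin 4, 2 * (A.natAbs + B.natAbs) :=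
        Finset.sum_le_sum fun i _ => Finset.sum_le_sum fun j _ => hb i j
    _ = 32 * (A.natAbs + B.natAbs) := by simp; ring

/-- `msize (M3 A B) ≤ 32 (|A| + |B|)`. -/
theorem msize_M3_le (A B : ℤ) : msize (M3 A B) ≤ 32 * (A.natAbs + B.natAbs) := by
  have hb : ∀ i j, (M3 A B i j).natAbs ≤ 2 * (A.natAbs + B.natAbs) := by
    intro i j
    fin_cases i <;> fin_cases j <;> simp [M3, M4, Int.natAbs_mul] <;> omega
  calc msize (M3 A B) = ∑ i, ∑ j, (M3 A B i j).natAbs := rfl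
    _ ≤ ∑ _i : Fin 4, ∑ _j : Fin 3, 2 * (A.natAbs + B.natAbs) :=
        Finset.sum_le_sum fun i _ => Finset.sum_le_sum fun j _ => hb i j
    _ = 24 * (A.natAbs + B.natAbs) := by simp; ring
    _ ≤ 32 * (A.natAbs + B.natAbs) := by omega

/-- `s = 2 + Σ|M| ≤ 3^{t_m+5}` for the member's matrices. -/
theorem sQ_le (m : ℕ) {S : ℕ} (hS : S ≤ 32 * ((AQ m).natAbs + (BQ m).natAbs)) :
    2 + (S : ℝ) ≤ (3 : ℝ) ^ (texp m + 5) := by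
  have h1 : (S : ℝ) ≤ 32 * (|(AQ m : ℝ)| + |(BQ m : ℝ)|) := by
    have := (Nat.cast_le (α := ℝ)).mpr hS
    push_cast [Nat.cast_natAbs] at this
    exact this
  have h2 : |(AQ m : ℝ)| + |(BQ m : ℝ)| ≤ (3 : ℝ) ^ (texp m + 1) := by
    have := AB_bound m
    exact_mod_cast this
  have h3 : (1 : ℝ) ≤ 3 ^ (texp m + 1) := one_le_pow₀ (by norm_num)
  calc 2 + (S : ℝ) ≤ 2 + 32 * 3 ^ (texp m + 1) := by linarith
    _ ≤ 81 * 3 ^ (texp m + 1) := by linarith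
    _ = 3 ^ (texp m + 5) := by ring

/-- `γ_m = A_m + B_m · s2` in `ℂ`. -/
theorem gamQ_cast (m : ℕ) : ((gamQ m : ℝ) : ℂ) = (AQ m : ℂ) + (BQ m : ℂ) * s2 := by
  rw [gamQ_eq]; unfold s2; push_cast; ring

/-- `‖ξ_Q − γ_m‖ = |ξ_Q − γ_m|`. -/
theorem norm_xiQ_sub_gamQ (m : ℕ) : ‖(xiQ : ℂ) - (gamQ m : ℂ)‖ = |xiQ - gamQ m| := by
  rw [← Complex.ofReal_sub, Complex.norm_real, Real.norm_eq_abs]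

/-- **`ξ_Q` is hyper-approximable through the order lattice `ω`, for the tuple `ω` itself …** -/
theorem hyperScaleApprox_xiQ4 : HyperScaleApprox ω4 ω4 (xiQ : ℂ) := by
  intro m
  refine ⟨(gamQ m : ℂ), M4 (AQ m) (BQ m), Complex.ofReal_ne_zero.mpr (gamQ_pos m).ne', ?_, ?_⟩
  · intro j; rw [gamQ_cast]; exact lattice4 _ _ j
  · rw [norm_xiQ_sub_gamQ]
    exact xiQ_approx m (by positivity) (sQ_le m (msize_M4_le _ _))

/-- **… and for the sub-tuple `y⁽³⁾ = (1, √2, i)`.** -/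
theorem hyperScaleApprox_xiQ3 : HyperScaleApprox ω4 y3 (xiQ : ℂ) := by
  intro m
  refine ⟨(gamQ m : ℂ), M3 (AQ m) (BQ m), Complex.ofReal_ne_zero.mpr (gamQ_pos m).ne', ?_, ?_⟩
  · intro j; rw [gamQ_cast]; exact lattice3 _ _ j
  · rw [norm_xiQ_sub_gamQ]
    exact xiQ_approx m (by positivity) (sQ_le m (msize_M3_le _ _))

/-- `s2 = √2` is algebraic. -/
theorem isAlgebraic_s2 : IsAlgebraic ℚ s2 :=
  ⟨Polynomial.X ^ 2 - Polynomial.C 2, Polynomial.X_pow_sub_C_ne_zero (by norm_num) 2,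
    by simp [sq, s2_mul_s2]⟩

/-- `i` is algebraic. -/
private theorem isAlgebraic_I' : IsAlgebraic ℚ I :=
  ⟨Polynomial.X ^ 2 - Polynomial.C (-1), Polynomial.X_pow_sub_C_ne_zero (by norm_num) _, by simp⟩

/-- The frame `ω4 = (1, √2, i, i√2)` consists of algebraic numbers. -/
theorem ω4_algebraic : ∀ i, IsAlgebraic ℚ (ω4 i) := by
  intro i
  fin_cases i
  · simpa [ω4] using isAlgebraic_one
  · simpa [ω4] using isAlgebraic_s2
  · simpa [ω4] using isAlgebraic_I'
  · simpa [ω4] using isAlgebraic_I'.mul isAlgebraic_s2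

/-- `a + b√2 = 0` with `a, b ∈ ℚ` forces `a = b = 0`. -/
private theorem rat_sqrt_two {a b : ℚ} (h : (a : ℝ) + b * Real.sqrt 2 = 0) : a = 0 ∧ b = 0 := by
  by_cases hb : b = 0
  · subst hb
    simp at h
    exact ⟨by exact_mod_cast h, rfl⟩
  · exfalso
    apply irrational_sqrt_two
    refine ⟨-a / b, ?_⟩
    have hb' : (b : ℝ) ≠ 0 := by exact_mod_cast hb
    push_cast
    field_simp
    linarith

/-- The frame `ω4 = (1, √2, i, i√2)` is ℚ-linearly independent. -/
theorem ω4_linearIndependent : LinearIndependent ℚ ω4 := by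
  rw [Fintype.linearIndependent_iff]
  intro g hg
  rw [Fin.sum_univ_four] at hg
  have hre := congrArg Complex.re hg
  have him := congrArg Complex.im hg
  simp [ω4, s2, Rat.smul_def] at hre him
  obtain ⟨h0, h1⟩ := rat_sqrt_two hre
  obtain ⟨h2, h3⟩ := rat_sqrt_two him
  intro i
  fin_cases i <;> assumption

/-- **THE MEMBERS.** -/
def zQ4 : Fin 4 → ℂ := fun j => (xiQ : ℂ) * ω4 j
/-- The member triple `z_Q⁽³⁾ = ξ_Q · (1, √2, i)`. -/
def zQ3 : Fin 3 → ℂ := fun j => (xiQ : ℂ) * y3 j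

/-- `ξ_Q ≠ 0` in `ℂ`. -/
private theorem xiQ_ne_zero : (xiQ : ℂ) ≠ 0 := Complex.ofReal_ne_zero.mpr xiQ_pos.ne'

/-- `z_Q⁽⁴⁾` is ℚ-linearly independent. -/
theorem zQ4_linearIndependent : LinearIndependent ℚ zQ4 :=
  linearIndependent_scale xiQ_ne_zero ω4_linearIndependent

/-- `y3 = (1, √2, i)` is ℚ-linearly independent. -/
theorem y3_linearIndependent : LinearIndependent ℚ y3 :=
  ω4_linearIndependent.comp Fin.castSucc (Fin.castSucc_injective 3)

/-- `z_Q⁽³⁾` is ℚ-linearly independent. -/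
theorem zQ3_linearIndependent : LinearIndependent ℚ zQ3 :=
  linearIndependent_scale xiQ_ne_zero y3_linearIndependent

/-- `z_Q⁽⁴⁾` lies in the scale class. -/
theorem zQ4_inScaleClass : InScaleClass zQ4 :=
  ⟨4, ω4, ω4, xiQ, ω4_algebraic, ω4_linearIndependent, hyperScaleApprox_xiQ4, rfl⟩

/-- `z_Q⁽³⁾` lies in the scale class. -/
theorem zQ3_inScaleClass : InScaleClass zQ3 :=
  ⟨4, ω4, y3, xiQ, ω4_algebraic, ω4_linearIndependent, hyperScaleApprox_xiQ3, rfl⟩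

/-- `√2` is not rational (as an element of `ℂ`). -/
theorem s2_not_rat : s2 ∉ Set.range (algebraMap ℚ ℂ) := by
  rintro ⟨q, hq⟩
  rw [eq_ratCast] at hq
  have h := congrArg Complex.re hq
  simp [s2] at h
  exact irrational_sqrt_two ⟨q, h⟩

/-- **E-stability certificate of `z_Q⁽⁴⁾`** (`β = √2`): the tuple is a line over `ℚ(√2, i)`. -/
theorem zQ4_eStable : ∃ β : ℂ, IsAlgebraic ℚ β ∧ β ∉ Set.range (algebraMap ℚ ℂ) ∧
    ∀ i, β * zQ4 i ∈ Submodule.span ℚ (Set.range zQ4) := by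
  refine ⟨s2, isAlgebraic_s2, s2_not_rat, fun i => ?_⟩
  have mem : ∀ j, zQ4 j ∈ Submodule.span ℚ (Set.range zQ4) :=
    fun j => Submodule.subset_span ⟨j, rfl⟩
  have h2 := s2_mul_s2
  fin_cases i
  · show s2 * zQ4 0 ∈ _
    have e : s2 * zQ4 0 = zQ4 1 := by simp [zQ4, ω4]; ring
    rw [e]; exact mem 1
  · show s2 * zQ4 1 ∈ _
    have e : s2 * zQ4 1 = (2 : ℚ) • zQ4 0 := by
      simp [zQ4, ω4, Rat.smul_def]; linear_combination (xiQ : ℂ) * h2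
    rw [e]; exact Submodule.smul_mem _ _ (mem 0)
  · show s2 * zQ4 2 ∈ _
    have e : s2 * zQ4 2 = zQ4 3 := by simp [zQ4, ω4]; ring
    rw [e]; exact mem 3
  · show s2 * zQ4 3 ∈ _
    have e : s2 * zQ4 3 = (2 : ℚ) • zQ4 2 := by
      simp [zQ4, ω4, Rat.smul_def]; linear_combination ((xiQ : ℂ) * I) * h2
    rw [e]; exact Submodule.smul_mem _ _ (mem 2)

/-- **`S` at the member `z_Q⁽⁴⁾` (n = 4):** `e^{ξ_Q}, e^{ξ_Q√2}, e^{iξ_Q}, e^{iξ_Q√2}` and `z_Q⁽⁴⁾` give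
`trdeg ≥ 4` — the first DECIDED quartic E-line of item 31409's open cell `n = 4` (mod `hLW`). -/
theorem schanuel_at_zQ4 (hLW : LWMeasure) : SB 4 zQ4 :=
  schanuel_on_scaleClass hLW 4 zQ4 zQ4_linearIndependent zQ4_inScaleClass

/-- **`S` at the member `z_Q⁽³⁾` (n = 3).** -/
theorem schanuel_at_zQ3 (hLW : LWMeasure) : SB 3 zQ3 :=
  schanuel_on_scaleClass hLW 3 zQ3 zQ3_linearIndependent zQ3_inScaleClass

/-- **Item 31409 `EStableDefectOne` APPLIED to the member** — the certificates `zQ4_linearIndependent`,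
`zQ4_eStable` ARE the item's scope hypotheses at `z := zQ4`, `n := 4` (its first open length); only the
induction-hypothesis binder (the item's GIFT to a prover, not a scope condition) remains a parameter. -/
theorem item31409_applied_at_zQ4 (h31409 : Summit.Schanuel.Schanuel.Theses.RootDecomp1E.EStableDefectOne)
    (hIH : ∀ (m : ℕ) (w : Fin m → ℂ), m < 4 → LinearIndependent ℚ w →
        (∀ j, w j ∈ Submodule.span ℚ (Set.range zQ4)) →
        (m : Cardinal) ≤ Algebra.trdeg ℚ ↥(IntermediateField.adjoin ℚ
          (Set.range w ∪ Set.range (Complex.exp ∘ w))) + 1) :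
    ((4 : ℕ) : Cardinal) ≤ Algebra.trdeg ℚ ↥(IntermediateField.adjoin ℚ
        (Set.range zQ4 ∪ Set.range (Complex.exp ∘ zQ4))) + 1 :=
  h31409 4 zQ4 zQ4_linearIndependent zQ4_eStable hIH

/-- … and the cell theorem DISCHARGES the same instance unconditionally in the item (mod `hLW`). -/
theorem item31409_instance_at_zQ4 (hLW : LWMeasure)
    (hIH : ∀ (m : ℕ) (w : Fin m → ℂ), m < 4 → LinearIndependent ℚ w →
        (∀ j, w j ∈ Submodule.span ℚ (Set.range zQ4)) →
        (m : Cardinal) ≤ Algebra.trdeg ℚ ↥(IntermediateField.adjoin ℚ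
          (Set.range w ∪ Set.range (Complex.exp ∘ w))) + 1) :
    ((4 : ℕ) : Cardinal) ≤ Algebra.trdeg ℚ ↥(IntermediateField.adjoin ℚ
        (Set.range zQ4 ∪ Set.range (Complex.exp ∘ zQ4))) + 1 :=
  eStableDefectOne_scaleCell hLW 4 zQ4 zQ4_linearIndependent zQ4_inScaleClass zQ4_eStable hIH

/-! ### §5c Plainness of `z_Q⁽³⁾`, the induction binders at `n = 3`, and the items APPLIED -/

/-- `y3 0 = 1`. -/
theorem y3_zero : y3 0 = 1 := rfl
/-- `y3 1 = √2`. -/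
theorem y3_one : y3 1 = s2 := rfl
/-- `y3 2 = i`. -/
theorem y3_two : y3 2 = I := rfl

/-- Coordinates in the ℚ-span of `z_Q⁽³⁾`: `v = ξ_Q (a + b√2 + c i)` with `a, b, c ∈ ℚ`. -/
theorem span_zQ3_coords {v : ℂ} (hv : v ∈ Submodule.span ℚ (Set.range zQ3)) :
    ∃ a b c : ℚ, v = (xiQ : ℂ) * ((a : ℂ) + (b : ℂ) * s2 + (c : ℂ) * I) := by
  obtain ⟨c, rfl⟩ := (Submodule.mem_span_range_iff_exists_fun ℚ).mp hv
  refine ⟨c 0, c 1, c 2, ?_⟩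
  rw [Fin.sum_univ_three]
  simp only [zQ3, y3_zero, y3_one, y3_two, Rat.smul_def]
  ring

/-- **Plainness certificate of `z_Q⁽³⁾`:** an algebraic `β` with `β · z_Q⁽³⁾ ⊆ span_ℚ z_Q⁽³⁾` is rational
(`span = ξ_Q · ℚ⟨1, √2, i⟩` has only rational multipliers: `√2·i ∉ ℚ⟨1, √2, i⟩`). -/
theorem zQ3_plain : ∀ β : ℂ, IsAlgebraic ℚ β →
    (∀ i, β * zQ3 i ∈ Submodule.span ℚ (Set.range zQ3)) → β ∈ Set.range (algebraMap ℚ ℂ) := by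
  intro β _ hβ
  have hξ := xiQ_ne_zero
  obtain ⟨a0, a1, a2, h0⟩ := span_zQ3_coords (hβ 0)
  obtain ⟨b0, b1, b2, h1⟩ := span_zQ3_coords (hβ 1)
  obtain ⟨d0, d1, d2, h2⟩ := span_zQ3_coords (hβ 2)
  rw [show zQ3 0 = (xiQ : ℂ) * 1 from rfl] at h0
  rw [show zQ3 1 = (xiQ : ℂ) * s2 from rfl] at h1
  rw [show zQ3 2 = (xiQ : ℂ) * I from rfl] at h2
  have cancel : ∀ {p q : ℂ}, (xiQ : ℂ) * p = (xiQ : ℂ) * q → p = q :=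
    fun h => mul_left_cancel₀ hξ h
  have hβeq : β = (a0 : ℂ) + (a1 : ℂ) * s2 + (a2 : ℂ) * I :=
    cancel (by linear_combination h0)
  have h2' : β * I = (d0 : ℂ) + (d1 : ℂ) * s2 + (d2 : ℂ) * I :=
    cancel (by linear_combination h2)
  have h1' : β * s2 = (b0 : ℂ) + (b1 : ℂ) * s2 + (b2 : ℂ) * I :=
    cancel (by linear_combination h1)
  rw [hβeq] at h2' h1'
  -- imaginary part of h2': a0 + a1 √2 = d2 ⇒ a1 = 0
  have him2 := congrArg Complex.im h2'
  simp [s2] at him2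
  have ha1 : a1 = 0 :=
    (rat_sqrt_two (a := a0 - d2) (b := a1) (by push_cast; linarith)).2
  -- imaginary part of h1': a2 √2 = b2 ⇒ a2 = 0
  have him1 := congrArg Complex.im h1'
  simp [s2] at him1
  have ha2 : a2 = 0 :=
    (rat_sqrt_two (a := -b2) (b := a2) (by push_cast; linarith)).2
  refine ⟨a0, ?_⟩
  rw [eq_ratCast, hβeq, ha1, ha2]; push_cast; ring

open Summit.Schanuel.Schanuel.Theorems.RootDecomp1EEStableRung (defectOne_of_le_two) in
/-- At length `3` the induction binder of items 31409/31410 is a tree theorem (`S⁻` in lengths `≤ 2`,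
Hermite–Lindemann, `defectOne_of_le_two`). -/
theorem ih_at_three (z : Fin 3 → ℂ) :
    ∀ (m : ℕ) (w : Fin m → ℂ), m < 3 → LinearIndependent ℚ w →
      (∀ j, w j ∈ Submodule.span ℚ (Set.range z)) →
      (m : Cardinal) ≤ Algebra.trdeg ℚ ↥(IntermediateField.adjoin ℚ
        (Set.range w ∪ Set.range (Complex.exp ∘ w))) + 1 :=
  fun m w hm hw _ => defectOne_of_le_two m (by omega) w hw

/-- **Item 31410 `PlainDefectOne` APPLIED to the member `z_Q⁽³⁾`, ALL hypotheses discharged** — its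
scope hypotheses at `z := zQ3`, `n := 3` (its first open length) ARE the certificates
`zQ3_linearIndependent`, `zQ3_plain`, and the induction binder is `ih_at_three`. -/
theorem item31410_applied_at_zQ3 (h31410 : Summit.Schanuel.Schanuel.Theses.RootDecomp1E.PlainDefectOne) :
    ((3 : ℕ) : Cardinal) ≤ Algebra.trdeg ℚ ↥(IntermediateField.adjoin ℚ
        (Set.range zQ3 ∪ Set.range (Complex.exp ∘ zQ3))) + 1 :=
  h31410 3 zQ3 zQ3_linearIndependent zQ3_plain (ih_at_three zQ3)

/-- … and the cell theorem proves that instance (mod `hLW`). -/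
theorem item31410_instance_at_zQ3 (hLW : LWMeasure) :
    ((3 : ℕ) : Cardinal) ≤ Algebra.trdeg ℚ ↥(IntermediateField.adjoin ℚ
        (Set.range zQ3 ∪ Set.range (Complex.exp ∘ zQ3))) + 1 :=
  plainDefectOne_scaleCell hLW 3 zQ3 zQ3_linearIndependent zQ3_inScaleClass zQ3_plain (ih_at_three zQ3)

/-- **Item 25020 `DefectOneSchanuel` (S⁻) APPLIED to the member `z_Q⁽³⁾`** (first open length `3`). -/
theorem item25020_applied_at_zQ3 (h25020 : Summit.Schanuel.Schanuel.Theses.RootDecomp1E.DefectOneSchanuel) :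
    ((3 : ℕ) : Cardinal) ≤ Algebra.trdeg ℚ ↥(IntermediateField.adjoin ℚ
        (Set.range zQ3 ∪ Set.range (Complex.exp ∘ zQ3))) + 1 :=
  h25020 3 zQ3 zQ3_linearIndependent

/-- … and the cell theorem proves that instance (mod `hLW`); indeed `S` itself: `schanuel_at_zQ3`. -/
theorem item25020_instance_at_zQ3 (hLW : LWMeasure) :
    ((3 : ℕ) : Cardinal) ≤ Algebra.trdeg ℚ ↥(IntermediateField.adjoin ℚ
        (Set.range zQ3 ∪ Set.range (Complex.exp ∘ zQ3))) + 1 :=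
  defectOneSchanuel_scaleCell hLW 3 zQ3 zQ3_linearIndependent zQ3_inScaleClass

/-- Literal member read-outs. -/
theorem zQ4_def (j : Fin 4) : zQ4 j = (xiQ : ℂ) * ![1, s2, I, I * s2] j := rfl
/-- `z_Q⁽³⁾ j = ξ_Q · (1, √2, i, i√2)_j` for `j < 3` (literal form). -/
theorem zQ3_def (j : Fin 3) : zQ3 j = (xiQ : ℂ) * ![(1 : ℂ), s2, I, I * s2] (Fin.castSucc j) := rfl
/-- `ξ_Q = Σ_k (√2 − 1)^{texp k}` (literal form). -/
theorem xiQ_def : xiQ = ∑' k, (Real.sqrt 2 - 1) ^ texp k := rfl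
/-- `texp 1 = 9`. -/
theorem texp_one : texp 1 = 9 := by rw [texp_succ, texp_zero]; norm_num

end Summit.Schanuel.Schanuel.Theorems.RootDecomp1EScaleTransfer

end
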